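import Summits.ResolutionOfSingularities.ResolutionOfSingularities.Theorems.MaxContactCutSurfaceShadow
import Summits.ResolutionOfSingularities.ResolutionOfSingularities.Theorems.CornerTowerDynamics
import HarnessLib

/-!
# MaxContactCutCornerTowers — leaf #17′ `NoCornerTowers` DISCHARGED BY NAME in the MaxContactCut cone

(decomp-res writer g5; node N54 HugDimension / N55 SurfaceShadow × the landed corner-tower dynamics of lens-3 g12
ProximityCut rev 3a §3e/§6b/§7 and lens-5 g13 CornerTowerDescent.)

`HugDimensionClasses.NoCornerTowers` (the monomial-stage «corner tower» leaf of the hugging-dimension cut, booked so far as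
KNOWN-MOD-PORT through `MaxContactCut.MonomialCornerAll` 32205 + a port) is now a THEOREM of the tree:
`CornerTowerDynamics.noCornerTowers_tree` (all marking sizes: `d ≤ 3` by `CornerTowerDescent`, `d = 4` by the two-letter /
three-letter dynamics `CornerTowerDynamicsTwo` / `CornerTowerDynamicsThree`).  This file re-keys every landed MaxContactCut
kernel that carried `NoCornerTowers` as a hypothesis (`MaxContactCutHugDimension` :88–:136, :178–:229;
`MaxContactCutSurfaceShadow` :136–:212) with that hypothesis discharged; in particular the aside **32200
`MaxContactCut.NoMonomialTowers` now follows from the port aside 32205 `MonomialCornerAll` ALONE**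
(`noMonomialTowers_of_monomialCorner`).  Every statement is a one-line application; 0 sorry.
(Sources: Hauser2010 §§D–G; HauserPerlega2019; CossartJannsenSaito2020.)
-/

namespace Summit.ResolutionOfSingularities.ResolutionOfSingularities.Theorems.MaxContactCutCornerTowers

open Summit.ResolutionOfSingularities.ResolutionOfSingularities.Theses
open Summit.ResolutionOfSingularities.ResolutionOfSingularities.Theorems
open HugDimensionClasses

/-- Leaf #17′ of the hugging-dimension cut, PROVED (re-export of `CornerTowerDynamics.noCornerTowers_tree`). [folklore] -/
theorem noCornerTowers : NoCornerTowers := CornerTowerDynamics.noCornerTowers_tree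

/-! ## `MaxContactCutHugDimension` with `hC` discharged -/

/-- **32200 `NoMonomialTowers` from the port aside 32205 `MonomialCornerAll` alone.** [folklore] -/
theorem noMonomialTowers_of_monomialCorner (hM : MaxContactCut.MonomialCornerAll) : MaxContactCut.NoMonomialTowers :=
  MaxContactCutHugDimension.noMonomialTowers_of_ports hM noCornerTowers

/-- 31570 `NoHuggingTowers` from 32205 and the non-monomial piece. [folklore] -/
theorem noHuggingTowers_of_pieces (hM : MaxContactCut.MonomialCornerAll) (hN : MaxContactCut.NoNonMonomialTowers) :
    MaxContactCut.NoHuggingTowers :=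
  MaxContactCutHugDimension.noHuggingTowers_of_pieces hM noCornerTowers hN

/-- 31570 `NoHuggingTowers` from 32205 and the three `w`-leaves. [folklore] -/
theorem noHuggingTowers_of_leaves (hM : MaxContactCut.MonomialCornerAll) (hL : MaxContactCut.CurveLawAll)
    (hS : MaxContactCut.NoSurfaceHuggingTowers) (hH : MaxContactCut.NoHypersurfaceHuggingTowers) :
    MaxContactCut.NoHuggingTowers :=
  MaxContactCutHugDimension.noHuggingTowers_of_leaves hM noCornerTowers hL hS hH

/-- **30253 `NoForcedTowers` from 32205 and the non-monomial piece.** [folklore] -/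
theorem noForcedTowers_of_pieces (hM : MaxContactCut.MonomialCornerAll) (hN : MaxContactCut.NoNonMonomialTowers) :
    MaxContactCut.NoForcedTowers :=
  MaxContactCutHugDimension.noForcedTowers_of_pieces hM noCornerTowers hN

/-- **EXACT modulo 32205 only: `NoForcedTowers ⟺ NoNonMonomialTowers`.** [folklore] -/
theorem noForcedTowers_iff_nonMonomial (hM : MaxContactCut.MonomialCornerAll) :
    MaxContactCut.NoForcedTowers ↔ MaxContactCut.NoNonMonomialTowers :=
  MaxContactCutHugDimension.noForcedTowers_iff_nonMonomial hM noCornerTowers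

/-- 30253 from 32205 and the three `w`-leaves. [folklore] -/
theorem noForcedTowers_of_leaves (hM : MaxContactCut.MonomialCornerAll) (hL : MaxContactCut.CurveLawAll)
    (hS : MaxContactCut.NoSurfaceHuggingTowers) (hH : MaxContactCut.NoHypersurfaceHuggingTowers) :
    MaxContactCut.NoForcedTowers :=
  MaxContactCutHugDimension.noForcedTowers_of_leaves hM noCornerTowers hL hS hH

/-- 30253 from the generator-hugging port, 32205 and 31570. [folklore] -/
theorem noForcedTowers_of_hugging (hG : MaxContactCut.GeneratorHuggingAll) (hM : MaxContactCut.MonomialCornerAll)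
    (hH : MaxContactCut.NoHuggingTowers) : MaxContactCut.NoForcedTowers :=
  MaxContactCutHugDimension.noForcedTowers_of_hugging hG hM noCornerTowers hH

/-! ## `MaxContactCutSurfaceShadow` with `hK` discharged -/

/-- 31570 from 32205, the curve law, the surface law and the two g11 leaves. [folklore] -/
theorem noHuggingTowers_of_g11 (hM : MaxContactCut.MonomialCornerAll) (hC : MaxContactCut.CurveLawAll)
    (hL : MaxContactCut.SurfaceLawAll) (hS : MaxContactCut.NoSingularSurfaceHuggingTowers)
    (hH : MaxContactCut.NoHypersurfaceHuggingTowers) : MaxContactCut.NoHuggingTowers :=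
  MaxContactCutSurfaceShadow.noHuggingTowers_of_g11 hM noCornerTowers hC hL hS hH

/-- **30253 from 32205, the curve law, the surface law and the two g11 leaves** (no tree port 31573). [folklore] -/
theorem noForcedTowers_of_g11' (hM : MaxContactCut.MonomialCornerAll) (hC : MaxContactCut.CurveLawAll)
    (hL : MaxContactCut.SurfaceLawAll) (hS : MaxContactCut.NoSingularSurfaceHuggingTowers)
    (hH : MaxContactCut.NoHypersurfaceHuggingTowers) : MaxContactCut.NoForcedTowers :=
  MaxContactCutSurfaceShadow.noForcedTowers_of_g11' hM noCornerTowers hC hL hS hH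

/-- **EXACT modulo 32205 + curve law + surface law: 30253 ⟺ singular-surface leaf ∧ hypersurface leaf.** [folklore] -/
theorem noForcedTowers_iff_g11_leaves (hM : MaxContactCut.MonomialCornerAll) (hC : MaxContactCut.CurveLawAll)
    (hL : MaxContactCut.SurfaceLawAll) :
    MaxContactCut.NoForcedTowers ↔
      MaxContactCut.NoSingularSurfaceHuggingTowers ∧ MaxContactCut.NoHypersurfaceHuggingTowers :=
  MaxContactCutSurfaceShadow.noForcedTowers_iff_g11_leaves hM noCornerTowers hC hL

/-- **EXACT modulo 32205 + surface law: 30253 ⟺ `NoRoughTowers`.** [folklore] -/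
theorem noForcedTowers_iff_noRoughTowers (hM : MaxContactCut.MonomialCornerAll) (hL : MaxContactCut.SurfaceLawAll) :
    MaxContactCut.NoForcedTowers ↔ MaxContactCut.NoRoughTowers :=
  MaxContactCutSurfaceShadow.noForcedTowers_iff_noRoughTowers hM noCornerTowers hL

end Summit.ResolutionOfSingularities.ResolutionOfSingularities.Theorems.MaxContactCutCornerTowers
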